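import Summits.KontsevichZagierPeriods.Zeta5Search.WedgeDictionaryClosedForms
import HarnessLib

/-!
# Factorial bookkeeping for CF-M3 on the faces (cell `pub-zeta5`)

HONEST FRAMING: systematic search; no irrationality claim unless certified.

OUR work (Summit side; lead/literature seat generation 4, 2026-08-20). Elementary lemmas about the pair list `allPairs`
of `WedgeDictionaryClosedForms` and the factorials `(m.toNat)!` used by `WedgeDictionaryFace` (CF-M3 on the faces
`{b_j = 0}`): membership and symmetric form of the pair-sum hypothesis, `((m+1).toNat)! = (m+1)·(m.toNat)!`, the ratio
of the pair products along a coordinate step (`pairRatio_prod`, shape by shape in the direction `i < 6`) and the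
invariance of the pair product under the slot transposition `(j 7)` (`pairProd_swap7`).
-/

open Finset

namespace Summit.KontsevichZagierPeriods.Zeta5Search.WedgeDictionary

/-! ### Factorial bookkeeping along a coordinate step -/

/-- Membership in `allPairs` of an ordered pair from `[1,7]`. -/
theorem mem_allPairs_of_lt : ∀ j k : Fin 8, 1 ≤ j.val → j.val < k.val → (j.val, k.val) ∈ allPairs := by decide

/-- The pair-sum hypothesis of `casoratianClosedForm` in symmetric form. -/
theorem pair_le_of_allPairs {b : ℕ → ℤ} (hpairs : ∀ jk ∈ allPairs, b jk.1 + b jk.2 ≤ b 0) {j k : ℕ}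
    (hj : 1 ≤ j) (hj7 : j ≤ 7) (hk : 1 ≤ k) (hk7 : k ≤ 7) (hne : j ≠ k) : b j + b k ≤ b 0 := by
  rcases Nat.lt_or_gt_of_ne hne with h | h
  · exact hpairs (j, k) (mem_allPairs_of_lt ⟨j, by omega⟩ ⟨k, by omega⟩ hj h)
  · have := hpairs (k, j) (mem_allPairs_of_lt ⟨k, by omega⟩ ⟨j, by omega⟩ hk h)
    dsimp only at this
    omega

/-- `((m+1).toNat)! = (m+1)·(m.toNat)!` in `ℚ`, for `m ≥ 0`. -/
theorem toNat_factorial_succ (m : ℤ) (hm : 0 ≤ m) :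
    (((m + 1).toNat.factorial : ℕ) : ℚ) = ((m : ℚ) + 1) * ((m.toNat.factorial : ℕ) : ℚ) := by
  rw [show (m + 1).toNat = m.toNat + 1 by omega, Nat.factorial_succ]
  push_cast
  have : ((m.toNat : ℕ) : ℚ) = (m : ℚ) := by exact_mod_cast Int.toNat_of_nonneg hm
  rw [this]

/-- The ratio `∏_{j<k} (N − a_j − a_k)! / ∏_{j<k} (N − b_j − b_k)!` for `a = b − e_{i+1}`, as an explicit product
over the pairs through `i+1` (evaluated shape by shape in `i < 6`). -/
theorem pairRatio_prod (b : ℕ → ℤ) {i : ℕ} (hi : i < 6) :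
    (allPairs.map fun jk : ℕ × ℕ =>
        if jk.1 = i + 1 ∨ jk.2 = i + 1 then ((b 0 : ℚ) - b jk.1 - b jk.2 + 1) else 1).prod =
      (∏ k ∈ range 6, if k = i then (1 : ℚ) else ((b 0 : ℚ) - b (i + 1) - b (k + 1) + 1)) *
        ((b 0 : ℚ) - b (i + 1) - b 7 + 1) := by
  interval_cases i <;> simp [allPairs, prod_range_succ] <;> ring

/-- `∏_{j<k} (N − b_j − b_k)!` is invariant under the slot transposition `(j 7)` (evaluated shape by shape). -/
theorem pairProd_swap7 (b : ℕ → ℤ) {j : ℕ} (hj : j ∈ Icc 1 7) :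
    (allPairs.map fun jk : ℕ × ℕ =>
        ((b 0 - b (Equiv.swap j 7 jk.1) - b (Equiv.swap j 7 jk.2)).toNat.factorial : ℚ)).prod =
      (allPairs.map fun jk : ℕ × ℕ => ((b 0 - b jk.1 - b jk.2).toNat.factorial : ℚ)).prod := by
  obtain ⟨h1, h7⟩ := mem_Icc.1 hj
  interval_cases j <;>
    simp only [allPairs, List.map_cons, List.map_nil, List.prod_cons, List.prod_nil, Equiv.swap_apply_def,
      sub_sub, add_comm, Nat.reduceEqDiff, reduceIte] <;> ring

end Summit.KontsevichZagierPeriods.Zeta5Search.WedgeDictionary
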